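import Literature.AlgebraicGeometry.Resolution.KawasakiCentreSheaf
import Literature.AlgebraicGeometry.Resolution.KawasakiCharts
import Literature.AlgebraicGeometry.Motives.FormsEmbedding
import HarnessLib

/-!
# The chart values of Kawasaki's centre are the evaluated dehomogenisations

Topic: `Literature/AlgebraicGeometry/Resolution` (plumbing of the global step of Kawasaki's
Macaulayfication, Kawasaki 2000, §5). The centre `𝔟 = ∏ (z_i, …, z_d)𝒪_Y` of Kawasaki's blow-up is
typed over the generating-sections data of a `k`-morphism `r : Y → ℙⁿ_k`
(`KawasakiCentreSheaf.lean`: `chartVal r z N hz l j ∈ Γ(Y, r⁻¹D₊(x_j))`, the chart value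
`z_l / x_j^{N_l}` as the value of the section `z_l(s)` of `r^*𝒪(N_l)`), while the chart dictionary
of the annihilator ideals (`KawasakiCharts.lean`, `KawasakiChartBaseChange.lean`) evaluates
degree-zero fractions through `ProjFrac.evalAway ι (X j) : (k[x]_{(x_j)})₀ → Γ(Z, ι⁻¹D₊(x_j))`.
This file identifies the two currencies:

* `ofHom_U_eq_ZH` — the chart opens agree: `(ofHom r.left).U j = Z_{x_j}`;
* `chartVal_eq_evalAway` — **`z_l / x_j^{N_l}` (chart value) `= evalAway (x_j) (z_l / x_j^{N_l})`**
  (the fraction `Away.mk` of `HomogeneousLocalization`), by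
  `GeneratingSections.sectionsFun_ofHom_eq_app` (Hartshorne II Thm. 7.1 (a): the chart values
  of `ofHom r` are pulled back from `D₊(x_j)`);
* `germ_chartVal_eq` — hence the germs at a point of the chart agree (the form in which the
  pointwise verification consumes the centre, `stalkIdeal_kawasakiCentreSheaf`);
* `algebraMap_evalAway_mk_eq_germ_chartVal` — the same for a point `x` of the chart as a term of
  the open, through `algebraMap Γ(Z, Z_{x_j}) 𝒪_{Z,x} ∘ evalAway` (definitionally the map
  `chartToStalk` of `KawasakiChartStalk.lean`): the hypothesis `hg` of the scheme statement of the
  pointwise step (`KawasakiPointwise.lean`) for `g l := z_l / x_j^{N_l}`.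

Everything is proved; no named facts; no definitions. As in `KawasakiCharts.lean`, Mathlib's
`MvPolynomial.gradedAlgebra` (a `def`) is a local instance.

## References

* T. Kawasaki, *On Macaulayfication of Noetherian schemes*, Trans. AMS 352 (2000), proof of
  Thm. 5.1 (p. 2539). [Kawasaki2000]
* R. Hartshorne, *Algebraic Geometry* (1977), II Thm. 7.1 (a), II Prop. 2.5 (b). [Hartshorne1977]
-/

noncomputable section

open CategoryTheory AlgebraicGeometry TopologicalSpace HomogeneousLocalization MvPolynomial
open Literature.AlgebraicGeometry.Morphisms Literature.AlgebraicGeometry.Morphisms.ProjCech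
open Literature.AlgebraicGeometry.Motives Literature.AlgebraicGeometry.Motives.ProjFrac

universe u

attribute [local instance] MvPolynomial.gradedAlgebra

namespace Literature.AlgebraicGeometry.Resolution

variable {k : Type u} [Field k] {n : ℕ} {Y : SchemeOver k} (r : Y ⟶ projectiveSpace n k)
  {d : ℕ} (z : Fin d → MvPolynomial (Fin (n + 1)) k) (N : Fin d → ℕ)
  (hz : ∀ l, (z l).IsHomogeneous (N l))

/-- The chart opens of the generating-sections data of `r` are the `Z_{x_j} = r⁻¹ D₊(x_j)` of the
chart dictionary. [cite: Hartshorne1977, II Thm. 7.1 (a)] -/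
theorem ofHom_U_eq_ZH (j : Fin (n + 1)) :
    (GeneratingSections.ofHom r.left).U j = ZH (r.left : Y.left ⟶ PP k n) (X j) := rfl

/-- A form of degree `m` has degree `m • 1`, the degree bookkeeping of the fraction
`G / x_j^m ∈ (k[x]_{(x_j)})₀` (`Away.mk` over the degree-one generator `x_j`).
[cite: Hartshorne1977, II Prop. 2.5 (b) (proof)] -/
theorem mem_grading_smul_one_of_isHomogeneous {m : ℕ} {G : MvPolynomial (Fin (n + 1)) k}
    (hG : G.IsHomogeneous m) : G ∈ grading k n (m • 1) := by
  simpa using (hG : G ∈ grading k n m)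

/-- **The chart value `z_l / x_j^{N_l}` of the centre's form is the evaluated dehomogenisation**
`evalAway (x_j) (z_l / x_j^{N_l})` (the degree-zero fraction `Away.mk`, i.e. `dehomog`); any proof
of the degree side condition may be used, by proof irrelevance. [cite: Hartshorne1977, II Thm. 7.1 (a);
Kawasaki2000, proof of Thm. 5.1] -/
theorem chartVal_eq_evalAway (l : Fin d) (j : Fin (n + 1)) :
    chartVal r z N hz l j = evalAway (r.left : Y.left ⟶ PP k n) (X j)
      (Away.mk (grading k n) (Segre.X_mem k j) (N l) (z l)
        (mem_grading_smul_one_of_isHomogeneous (hz l))) := by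
  rw [chartVal, GeneratingSections.secOfForm_val,
    GeneratingSections.sectionsFun_ofHom_eq_app Y.hom r.left (Over.w r) j (z l)
      (hz l : z l ∈ grading k n (N l)), evalAway_apply]
  congr 1
  simp only [Away.isLocalizationElem, pow_one]

/-- **Germ form**: at a point `x ∈ r⁻¹D₊(x_j)` the germ of the chart value is the germ of the
evaluated dehomogenisation (the input `stalkIdeal_kawasakiCentreSheaf` of the pointwise step).
[cite: Kawasaki2000, proof of Thm. 5.1] -/
theorem germ_chartVal_eq (l : Fin d) (j : Fin (n + 1)) (x : Y.left)
    (hx : x ∈ (GeneratingSections.ofHom r.left).U j) :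
    (Y.left.presheaf.germ ((GeneratingSections.ofHom r.left).U j) x hx).hom (chartVal r z N hz l j) =
      (Y.left.presheaf.germ (ZH (r.left : Y.left ⟶ PP k n) (X j)) x hx).hom
        (evalAway (r.left : Y.left ⟶ PP k n) (X j)
          (Away.mk (grading k n) (Segre.X_mem k j) (N l) (z l)
            (mem_grading_smul_one_of_isHomogeneous (hz l)))) := by
  rw [chartVal_eq_evalAway]
  rfl

/-- **The germ of the chart value through the chart ring**: for a point `x` of the chart
`Z_{x_j}`, evaluating `z_l / x_j^{N_l}` on the chart and taking the germ at `x` (the composite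
`algebraMap Γ(Z, Z_{x_j}) 𝒪_{Z,x} ∘ evalAway`, i.e. `KawasakiChartStalk.chartToStalk` unfolded) gives
the germ of the centre's chart value `chartVal … l j`. [cite: Kawasaki2000, proof of Thm. 5.1] -/
theorem algebraMap_evalAway_mk_eq_germ_chartVal (l : Fin d) (j : Fin (n + 1))
    (x : ZH (r.left : Y.left ⟶ PP k n) (X j)) :
    algebraMap Γ(Y.left, ZH (r.left : Y.left ⟶ PP k n) (X j)) (Y.left.presheaf.stalk x.1)
        (evalAway (r.left : Y.left ⟶ PP k n) (X j)
          (Away.mk (grading k n) (Segre.X_mem k j) (N l) (z l)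
            (mem_grading_smul_one_of_isHomogeneous (hz l)))) =
      (Y.left.presheaf.germ ((GeneratingSections.ofHom r.left).U j) x.1 x.2).hom
        (chartVal r z N hz l j) := by
  rw [germ_chartVal_eq]
  rfl

end Literature.AlgebraicGeometry.Resolution

end
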